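import Summits.QuantumFields.YangMills.Theorems.BalabanUVNodesN15KingModelOneDimensionalClosedForm

/-!
# BalabanUVNodes ∕ N15 — THE KING-MODEL RUNG (PART Ϸ-q): THE ONE-DIMENSIONAL POSITION-SPACE CHECK — King's momentum-space `S₂^{ℝ}` in `d+1 = 1` EQUALS the
# unit-interval block averages of the Ornstein–Uhlenbeck covariance: `S₂^{ℝ}(t) = ∫₀¹∫₀¹e^{−m|t+x−y|}∕(2m)dydx` for integers `t ≥ 1` (Track A, DAG node N15 = NE2;
# FAN-OUT v1.1 §N15 s3 «KING-MODEL RUNG»; a consistency check of the tree's definition `kingS2Inf` incl. its `(2π)^{−(d+1)}` normalisation; count-neutral)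

HONEST FRAMING.  Count-neutral (cell `pub-ymgap`, seat `pub-ymgap-dag-n15-e` g34; `--supports stmt-QuantumFields-27366 --as helper` = K3⁸
`SpineGivenEndpointR13SepCoPHV`).  King's `A = 0`, `g = 0` model ([King1986] C. King, Commun. Math. Phys. **102** (1986) 649–677; `S₂^{ℝ}` (4.5) p.670, (4.36)
p.674) is DEFINED in the tree in momentum space (`kingS2Inf m2 z = (2π)^{−(d+1)}∫Π sinc²(p_μ∕2)cos(p·z)∕(p²+m²)dp`).  Its meaning is «the covariance of the unit-block
averages of the continuum free field of mass `m`», whose position-space covariance in one dimension is the Ornstein–Uhlenbeck kernel `C(x) = e^{−m|x|}∕(2m)`.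
This file checks the two against each other in `d+1 = 1`: the elementary double integral `∫₀¹∫₀¹e^{−m|t+x−y|}∕(2m)dydx = (cosh m − 1)m⁻³e^{−mt}` (`t ≥ 1`, where
`|t+x−y| = t+x−y`) coincides with part Ϸ-p's closed form of `kingS2Inf`, so `S₂^{ℝ}(t) = ∫₀¹∫₀¹C(t+x−y)dydx` — the definition, its block form factor `sinc²(p∕2)` and
its `(2π)⁻¹` normalisation are the right ones.  NOT a node discharge (N15 is booked through n15-a's knit, untouched here); nothing Bałaban ∕ continuum-Yang–Mills ∕ `ℝ⁴` ∕
OS ∕ Clay.  0 `sorry`, 0 def; standard axioms.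

WHAT THIS FILE PROVES (kernel).  `intervalIntegral_exp_mul` (`∫₀¹e^{cy}dy = (e^{c} − 1)∕c`), ★★ `ou_blockAverage_eq` (the double integral in closed form, real `t ≥ 1`),
★★★ **`kingS2Inf_dim_one_eq_ou_blockAverage`** (`S₂^{ℝ}(t) = ∫₀¹∫₀¹e^{−√m²|t+x−y|}∕(2√m²)dydx`, integers `t ≥ 1`).

HONEST SCOPE.  `d+1 = 1`, integers `t ≥ 1` (negative `t` by the evenness of both sides, not restated).  N15 untouched; counts unmoved.  Locators (use): [King1986] (4.5)
p.670, (4.36) p.674, (2.23) p.654.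
-/

noncomputable section

open scoped BigOperators Topology
open Filter MeasureTheory Set intervalIntegral

namespace Summit.QuantumFields.YangMills.BalabanUVNodes.N15KingModelRung.OptimalDecay

/-- `∫₀¹e^{cy}dy = (e^{c} − 1)∕c` for `c ≠ 0`. [folklore] -/
theorem intervalIntegral_exp_mul {c : ℝ} (hc : c ≠ 0) : ∫ y in (0 : ℝ)..1, Real.exp (c * y) = (Real.exp c - 1) / c := by
  rw [intervalIntegral.integral_comp_mul_left Real.exp hc, integral_exp]
  simp only [mul_zero, mul_one, Real.exp_zero, smul_eq_mul]
  field_simp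

/-- ★★ **The OU block average in closed form**: for `m > 0` and real `t ≥ 1`, `∫₀¹∫₀¹e^{−m|t+x−y|}∕(2m)dydx = (cosh m − 1)m⁻³e^{−mt}`. [folklore] -/
theorem ou_blockAverage_eq {m : ℝ} (hm : 0 < m) {t : ℝ} (ht : 1 ≤ t) :
    ∫ x in (0 : ℝ)..1, ∫ y in (0 : ℝ)..1, Real.exp (-(m * |t + x - y|)) / (2 * m) = (Real.cosh m - 1) / m ^ 3 * Real.exp (-(m * t)) := by
  have hm0 : m ≠ 0 := hm.ne'
  -- on the square `|t + x − y| = t + x − y`, and the inner integral is `e^{−m(t+x)}(e^{m} − 1)∕(2m²)`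
  have hinner : ∀ x ∈ uIcc (0 : ℝ) 1, ∫ y in (0 : ℝ)..1, Real.exp (-(m * |t + x - y|)) / (2 * m)
      = Real.exp (-(m * (t + x))) * ((Real.exp m - 1) / m) / (2 * m) := by
    intro x hx
    rw [uIcc_of_le zero_le_one] at hx
    have hcongr : EqOn (fun y : ℝ => Real.exp (-(m * |t + x - y|)) / (2 * m)) (fun y => Real.exp (-(m * (t + x))) / (2 * m) * Real.exp (m * y)) (uIcc (0 : ℝ) 1) := by
      intro y hy
      rw [uIcc_of_le zero_le_one] at hy
      simp only
      rw [abs_of_nonneg (by linarith [hx.1, hy.2]), show -(m * (t + x - y)) = -(m * (t + x)) + m * y by ring, Real.exp_add]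
      ring
    rw [intervalIntegral.integral_congr hcongr, intervalIntegral.integral_const_mul, intervalIntegral_exp_mul hm0]
    ring
  rw [intervalIntegral.integral_congr hinner]
  have hcongr2 : EqOn (fun x : ℝ => Real.exp (-(m * (t + x))) * ((Real.exp m - 1) / m) / (2 * m))
      (fun x => Real.exp (-(m * t)) * ((Real.exp m - 1) / m) / (2 * m) * Real.exp (-m * x)) (uIcc (0 : ℝ) 1) := by
    intro x _
    simp only
    rw [show -(m * (t + x)) = -(m * t) + -m * x by ring, Real.exp_add]
    ring
  rw [intervalIntegral.integral_congr hcongr2, intervalIntegral.integral_const_mul, intervalIntegral_exp_mul (neg_ne_zero.mpr hm0), Real.cosh_eq]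
  have he : Real.exp (-m) * Real.exp m = 1 := by rw [← Real.exp_add, neg_add_cancel, Real.exp_zero]
  field_simp
  linear_combination (-1 : ℝ) * he

/-- ★★★ **THE ONE-DIMENSIONAL POSITION-SPACE CHECK**: in `d+1 = 1`, for every integer `t ≥ 1`,
`S₂^{ℝ}(t) = ∫₀¹∫₀¹e^{−√m²|t+x−y|}∕(2√m²)dydx` — King's momentum-space block two-point function IS the unit-interval block average of the Ornstein–Uhlenbeck covariance
`e^{−m|x|}∕(2m)` (part Ϸ-p's closed form = the elementary double integral). [cite: King1986, (4.5) p.670, (4.36) p.674, (2.23) p.654] -/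
theorem kingS2Inf_dim_one_eq_ou_blockAverage {m2 : ℝ} (hm : 0 < m2) {t : ℤ} (ht : 1 ≤ t) :
    kingS2Inf m2 (Pi.single (0 : Fin 1) t)
      = ∫ x in (0 : ℝ)..1, ∫ y in (0 : ℝ)..1, Real.exp (-(Real.sqrt m2 * |(t : ℝ) + x - y|)) / (2 * Real.sqrt m2) := by
  have hm' : 0 < Real.sqrt m2 := Real.sqrt_pos.mpr hm
  have ht' : (1 : ℝ) ≤ (t : ℝ) := by exact_mod_cast ht
  have hta : 1 ≤ |(t : ℝ)| := ht'.trans (le_abs_self _)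
  rw [ou_blockAverage_eq hm' ht', kingS2Inf_dim_one_eq hm hta, abs_of_pos (by linarith)]

end Summit.QuantumFields.YangMills.BalabanUVNodes.N15KingModelRung.OptimalDecay
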